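import Summits.QuantumFields.BalabanUV.T4Continuum.Spine.NE1p.DressedSmallFieldRecordLabelsCarriers
import Summits.QuantumFields.BalabanUV.T4Continuum.Support.SubstrateBondsOfCubes

/-!
# T⁴ programme, spine estimate NE1′ (node O3b/H2) — N0y's ENDs AT THE CARRIERS OF RECORD WITH THE BONDS OF RECORD: N1a PART 2's two ENDs with
# N0u's `bondsOf`∕`hb₀` SUPPLIED by the substrate's W-23c `SubstrateBondsOfCubes` (`bondsOf := bondsOfFineCubes hk`, `b₀ := 4·L^{4m′}`) —
# owner node N1a PART 3

Cell `pub-balaban`, sub-cell `t4`, BINDER-OWNERS row NE1′; owner lineage t4-ne1p-p1 (PROVER seat P1), generation 31; owner node N1a, PART 3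
(the «one-line owner face» the substrate invited, `CLAIMS.log` 2026-08-20 l.22792).  ADDITIVE — imports PART 2
`Spine/NE1p/DressedSmallFieldRecordLabelsCarriers` and substrate W-23c `Support/SubstrateBondsOfCubes` (substrate-p1 g6: `bondsOfFineCubes`,
`card_bondsOfFineCubes_le_real`, `bondsIn_fineEmb_eq`) ONLY; THEOREMS ONLY (0 def, 0 `def … : Prop`, 0 cite); PART 2's ENDs used BY NAME once each.

WHAT.  `attachedPart_∕muPart_locE_le_of_actOfLetters_recordLabels_carriersBonds` = PART 2's ENDs ONCE at `bondsOf := bondsOfFineCubes hk`,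
`hb₀ := card_bondsOfFineCubes_le_real hk`: the owner's filter now reads `ℓ.Z₀ = trefineDom L N Z ∧ ℓ.P ⊆ bondsOfFineCubes hk (Z₀ ∖ ∪fam) ∧
#(Z₀ ∖ ∪fam) ≤ 2·#ℓ.P` — with NE5's well-formedness `ℓ.P ⊆ bondsIn R (fineEmb hk ℓ.Z₀) = bondsOfFineCubes hk ℓ.Z₀.1` (`bondsIn_fineEmb_eq`) this is
print's «bonds of P in the interior of Z₀, outside Y₀» KIND (p. 12), as a decidable predicate on labels; the rate clause reads
`Rkp ≤ Rc − 64·(e^{5Rc}·s·e^{4L^{4m′}·t})`.  DISPLAYED after PART 3: `hroom`; `hm`∕`hN`∕`hq`; `hO`∕`hH`; `hkill` (NE5's identification of the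
killed labels); `hAmp` ((B3-form) READING); the located clauses; N0m's `hϱ`∕`hϱA` ∕ road P1's `h0`∕`h01`∕`hμ`.  Nothing of N0u's geometric
bookkeeping (`Gk`, `foot`, `hmono`, `hlink`, `bondsOf`, `hb₀`) remains at the carriers of record.

PRINTED LOCI (TYPE∕CONTEXT only — [Balaban1988RGII] = CMP 116 (1988)): p. 12 «bonds of P have to be contained in the interior of Z₀»,
«𝐃 ⊂ 𝐃_k»; p. 18 «|P| ≥ ½M⁻⁴|Z₀∖Y₀|, because one bond in P may connect two cubes in Z₀∖Y₀».  `4·L^{4m′}` is the substrate's count on OUR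
lattice (a bond = source site × 4 directions, `(L^{m′})^4` sites per cube) — no numeral of print.  Nothing here is used as a fact about
Bałaban's densities.

HONEST FRAMING.  Two by-name applications over binder SHAPES on CONSTRUCTED carriers; 0 binders instantiated on Bałaban's (2.14) densities;
(B1b) at NE5's index = the FILTER (owner's READING) + `hkill` (NE5's READING) — NOT discharged on Bałaban's densities; wall v1.8 (T4-DAG v48 —
words, not kind) does NOT move; R-t4r2-Q2 NOT met thereby; NE1′ ⇐ the named binders — NOT printed, NOT proved; spine PROVED 0∕9; count 9
unchanged.  ABSOLUTE RULE honoured ([folklore] kernel theorems only; printed loci TYPE∕CONTEXT).  Rung (B)+1 on ONE finite four-torus — NOT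
infinite volume, NOT a mass gap, NOT OS on ℝ⁴, NOT Clay.  HONEST DEPENDENCY: continuum YM on T⁴ ⇐ BetaPertH ∧ nine spine estimates (0/9
proved); BetaPertH ⇐ (D1) ∧ (D4) ∧ CAP+tail; G-an2-4 gates asym, D1 and NE2/3/4. -/

noncomputable section

namespace Summit.QuantumFields.BalabanUV.T4Continuum.NE1p.DressedSmallFieldRecordLabelsCarriersBonds

open Metric Set Complex MeasureTheory
open scoped BigOperators
open Literature.MathematicalPhysics.QuantumFieldTheory.Balaban1983to89 (GaugeGroup)
open Literature.MathematicalPhysics.QuantumFieldTheory.Balaban1983to89.T4OutputRate (Carriers)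
open Literature.MathematicalPhysics.QuantumFieldTheory.Balaban1983to89.B13Resummation (locE)
open Literature.MathematicalPhysics.QuantumFieldTheory.Balaban1983to89.TreeLengthTorus (TPt TDom tsys torusTreeLen)
open Literature.MathematicalPhysics.QuantumFieldTheory.Balaban1983to89.TreeLengthTorusGeometry (tgeometry)
open Literature.MathematicalPhysics.QuantumFieldTheory.Balaban1983to89.B12TreeDecay (K₀)
open Summit.QuantumFields.BalabanUV.T4Continuum.B13HistMeasurable (MeasPotFrame B13HistM)
open Summit.QuantumFields.BalabanUV.T4Continuum.B13StepTermLabels (InnerLabel innerLabels)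
open Summit.QuantumFields.BalabanUV.T4Continuum.B13Carriers (TwoRuns)
open Summit.QuantumFields.BalabanUV.T4Continuum.B13InnerData (Bnd b13InnerData)
open Summit.QuantumFields.BalabanUV.T4Continuum.B13DomainGeometryTR (domEmb)
open Summit.QuantumFields.BalabanUV.T4Continuum.SubstrateActivities (CoreLetters coreOf actOfLetters)
open Summit.QuantumFields.BalabanUV.T4Continuum.SubstrateNestedToriOfRecord (InnerLabel.ofTorus torusLabels)
open Summit.QuantumFields.BalabanUV.T4Continuum.SubstrateBondsOfCubes (bondsOfFineCubes card_bondsOfFineCubes_le_real)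
open Summit.QuantumFields.BalabanUV.T4Continuum.TorusBlockRefinement (trefineDom)
open Summit.QuantumFields.BalabanUV.T4Continuum.NE1p.DressedSmallFieldRecordLabelsCarriers
  (attachedPart_locE_le_of_actOfLetters_recordLabels_carriers muPart_locE_le_of_actOfLetters_recordLabels_carriers)

section Bonds

variable {G : Type} [GaugeGroup G] (R : TwoRuns G) {k : ℕ} (hk : k + 1 + R.m' ≤ R.F.m + R.K)
variable (P : MeasPotFrame R.carriers) (Op : Type*) [NormedAddCommGroup Op] [NormedSpace ℂ Op]
  (𝒴 : R.carriers.Dom → InnerLabel R.carriers.Dom (Bnd R) → Type) [∀ X j, Fintype (𝒴 X j)] (dom : ∀ X j, 𝒴 X j → R.carriers.Dom)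
  (Jc : R.carriers.Dom → InnerLabel R.carriers.Dom (Bnd R) → Type) [∀ X j, Fintype (Jc X j)]
  (V : R.carriers.Dom → InnerLabel R.carriers.Dom (Bnd R) → Type) [∀ X j, NormedAddCommGroup (V X j)]
  [∀ X j, InnerProductSpace ℝ (V X j)] [∀ X j, MeasurableSpace (V X j)] [∀ X j, BorelSpace (V X j)] [∀ X j, FiniteDimensional ℝ (V X j)]

open Classical in
/-- **THE ATTACHED PART OF ROW NE5's CATALOGUE ACTIVITY AT THE CARRIERS OF RECORD WITH THE BONDS OF RECORD** — PART 2's attached END ONCE at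
`bondsOf := bondsOfFineCubes hk` (the substrate's W-23c: level-`k` bonds with both endpoint cubes in the given fine-torus cube set, so the
filter's bond clause reads «`P`'s bonds join UNCOVERED cubes of `Z₀`», print p. 12∕p. 18 KIND) and `hb₀ := card_bondsOfFineCubes_le_real hk`
(`b₀ = 4·L^{4m′}`: a bond = a source site × 4 directions, `L^{4m′}` sites per cube) — N0u's `bondsOf`∕`hb₀` GONE; the rate clause reads
`Rkp ≤ Rc − 64·(e^{5Rc}·s·e^{4L^{4m′}t})`.  **(original docstring of PART 2's END follows)**
(PART 2: §1's attached END ONCE at `C := R.carriers`, `N := R.cubesPerDir (k+1)`, `L := R.F.L`, `emb := domEmb R (k+1)` (`hscale` `rfl`),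
`T := torusLabels hk` (A), `φ := InnerLabel.ofTorus hk` (injective, (A)), `terms₀ Z := (torusLabels hk Z).filter` THE OWNER's FILTER
(`Z₀ = trefineDom L N Z`, `P ⊆ bondsOf (Z₀ ∖ ∪fam)`, `#(Z₀ ∖ ∪fam) ≤ 2·#P` — print's finer constraints + N0u's sub-case), `hadm` DISCHARGED by
`Finset.mem_filter` and (A)'s `mem_torusLabels_iff` («Y within Z₀»), and the conclusion moved to the catalogue sum by (A)'s
`sum_innerLabels_domEmb_eq`).  Displayed: `hroom`, `hm`∕`hN`∕`hq`, `hO`∕`hH`; `hkill` (every catalogue label failing the filter carries a killing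
χ-letter — NE5's identification); (B3-form) `hAmp` on the filtered labels; `bondsOf`∕`hb₀`; the located clauses; N0m's `hϱ`∕`hϱA`.  Conclusion:
`‖E[Z ↦ Σ_{ℓ' ∈ innerLabels (b13InnerData R) (k+1) (domEmb R (k+1) Z)} actOfLetters ℓA (domEmb R (k+1) Z) ℓ' o (h₀ + w)](X₀) − E[… o h₀](X₀)‖
≤ 4·(e·9·64·K₀(64,8)²)·A₁·e^{−r₁·torusTreeLen X₀}`. [folklore] -/
theorem attachedPart_locE_le_of_actOfLetters_recordLabels_carriersBonds {Win : Set (ℕ → ℝ)}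
    {ctr : ℕ → (ℕ → ℝ) → R.carriers.BgB → Op × B13HistM P} {ROp RHist R' : ℕ → ℝ}
    (ℓA : ∀ X j, CoreLetters P Op 𝒴 dom Jc V X j)
    {mq bq N₀ : ℕ → R.carriers.Dom × InnerLabel R.carriers.Dom (Bnd R) → R.carriers.Dom → ℝ}
    (hroom : ∀ k, ROp k < R' k)
    (hm : ∀ k, ∀ g ∈ Win, ∀ (U : R.carriers.BgB) (X : R.carriers.Dom), R.carriers.scale X = k → ∀ p, 0 < mq k p X)
    (hN : ∀ k, ∀ g ∈ Win, ∀ (U : R.carriers.BgB) (X : R.carriers.Dom), R.carriers.scale X = k →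
      ∀ p : R.carriers.Dom × InnerLabel R.carriers.Dom (Bnd R),
      (∀ o ∈ ball (ctr k g U).1 (R' k),
        AEStronglyMeasurable ((ℓA p.1 p.2).N o) (coreOf P Op 𝒴 dom Jc V ℓA p.1 p.2).lam) ∧
      (∀ a, DifferentiableOn ℂ (fun o => (ℓA p.1 p.2).N o a) (ball (ctr k g U).1 (R' k))) ∧
      (∀ o ∈ ball (ctr k g U).1 (R' k), ∀ a, ‖(ℓA p.1 p.2).N o a‖ ≤ N₀ k p X))
    (hq : ∀ k, ∀ g ∈ Win, ∀ (U : R.carriers.BgB) (X : R.carriers.Dom), R.carriers.scale X = k →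
      ∀ p : R.carriers.Dom × InnerLabel R.carriers.Dom (Bnd R),
      (∀ o ∈ ball (ctr k g U).1 (R' k),
        AEStronglyMeasurable (Function.uncurry ((ℓA p.1 p.2).q o))
          ((coreOf P Op 𝒴 dom Jc V ℓA p.1 p.2).lam.prod volume)) ∧
      (∀ a v, DifferentiableOn ℂ (fun o => (ℓA p.1 p.2).q o a v) (ball (ctr k g U).1 (R' k))) ∧
      (∀ o ∈ ball (ctr k g U).1 (R' k), ∀ a v, mq k p X * ‖v‖ ^ 2 - bq k p X ≤ ((ℓA p.1 p.2).q o a v).re))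
    {g : ℕ → ℝ} (hg : g ∈ Win) {U : R.carriers.BgB} {o : Op} {h₀ w : B13HistM P} {ϱ : ℝ}
    (hO : ‖o - (ctr (k + 1) g U).1‖ ≤ ROp (k + 1)) (hH : ‖h₀ - (ctr (k + 1) g U).2‖ + ϱ * ‖w‖ ≤ RHist (k + 1))
    (hkill : ∀ Z : (tsys 4 (R.cubesPerDir (k + 1))).Dom, ∀ ℓ ∈ torusLabels hk Z,
      ¬ (ℓ.Z₀ = trefineDom R.F.L (R.cubesPerDir (k + 1)) Z ∧
          ℓ.P ⊆ bondsOfFineCubes hk (ℓ.Z₀.1 \ ℓ.fam.biUnion fun Y : (tsys 4 (R.F.L * R.cubesPerDir (k + 1))).Dom => Y.1) ∧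
          (ℓ.Z₀.1 \ ℓ.fam.biUnion fun Y : (tsys 4 (R.F.L * R.cubesPerDir (k + 1))).Dom => Y.1).card ≤ 2 * ℓ.P.card) →
      ∃ (b : V (domEmb R (k + 1) Z) (InnerLabel.ofTorus hk ℓ) →L[ℝ] ℝ) (thr : ℝ), thr ≤ 0 ∧
        (b, thr, true) ∈ (ℓA (domEmb R (k + 1) Z) (InnerLabel.ofTorus hk ℓ)).cons)
    {A₀ A₁ Rkp r₁ : ℝ} (X₀ : (tsys 4 (R.cubesPerDir (k + 1))).Dom) (hA₀ : 0 ≤ A₀) (hA₁ : 0 ≤ A₁) (hr₁ : 0 ≤ r₁)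
    (hrate : r₁ + 2 * (64 * Real.log 162) + 2 ≤ Rkp)
    (hsmall : (A₀ + ϱ * A₁) * Real.exp (5 * r₁ + 1) * K₀ 64 8 * 9 * 64 ≤ 1)
    {δ κ α₆ Rc s t : ℝ} (hα₆ : 0 ≤ α₆)
    (hκ : 64 * Real.log 162 + 1 ≤ δ * κ) (h229 : Real.exp 1 * K₀ 64 8 * 64 * α₆ ≤ 1)
    (hs0 : 0 ≤ s) (hs1 : s ≤ 1) (ht : 0 ≤ t)
    (hRR : Rkp ≤ Rc - 64 * (Real.exp (Rc * 5) * s * Real.exp ((4 * (R.F.L : ℝ) ^ (4 * R.m')) * t)))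
    (hAmp : ∀ Z : (tsys 4 (R.cubesPerDir (k + 1))).Dom, Z.1 ⊆ X₀.1 → ∀ ℓ ∈ (torusLabels hk Z).filter fun ℓ =>
        ℓ.Z₀ = trefineDom R.F.L (R.cubesPerDir (k + 1)) Z ∧
          ℓ.P ⊆ bondsOfFineCubes hk (ℓ.Z₀.1 \ ℓ.fam.biUnion fun Y : (tsys 4 (R.F.L * R.cubesPerDir (k + 1))).Dom => Y.1) ∧
          (ℓ.Z₀.1 \ ℓ.fam.biUnion fun Y : (tsys 4 (R.F.L * R.cubesPerDir (k + 1))).Dom => Y.1).card ≤ 2 * ℓ.P.card,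
      (coreOf P Op 𝒴 dom Jc V ℓA (domEmb R (k + 1) Z) (InnerLabel.ofTorus hk ℓ)).lam.real univ *
          ((coreOf P Op 𝒴 dom Jc V ℓA (domEmb R (k + 1) Z) (InnerLabel.ofTorus hk ℓ)).wB *
              N₀ (k + 1) (domEmb R (k + 1) Z, InnerLabel.ofTorus hk ℓ) (domEmb R (k + 1) Z) *
            Real.exp (bq (k + 1) (domEmb R (k + 1) Z, InnerLabel.ofTorus hk ℓ) (domEmb R (k + 1) Z))) *
          (Real.pi / (mq (k + 1) (domEmb R (k + 1) Z, InnerLabel.ofTorus hk ℓ) (domEmb R (k + 1) Z) / 2)) ^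
            (Module.finrank ℝ (V (domEmb R (k + 1) Z) (InnerLabel.ofTorus hk ℓ)) / 2 : ℝ) *
        Real.exp ((coreOf P Op 𝒴 dom Jc V ℓA (domEmb R (k + 1) Z) (InnerLabel.ofTorus hk ℓ)).N₁ * (‖h₀‖ + ϱ * ‖w‖)) ≤
      (A₀ + ϱ * A₁) * ((∏ Y ∈ ℓ.fam, (α₆ * Real.exp (-(δ * κ * torusTreeLen Y.1)) *
        Real.exp (-(Rc * (torusTreeLen Y.1 + 5))))) * (s ^ 2 * t) ^ ℓ.P.card))
    (hϱ : 2 ≤ ϱ) (hϱA : A₀ ≤ ϱ * A₁) :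
    ‖locE (tgeometry 4 (R.cubesPerDir (k + 1))).ι (tgeometry 4 (R.cubesPerDir (k + 1))).cubes
          (fun Z => ∑ ℓ' ∈ innerLabels (b13InnerData R) (k + 1) (domEmb R (k + 1) Z),
            actOfLetters P Op 𝒴 dom Jc V ℓA (domEmb R (k + 1) Z) ℓ' o (h₀ + w)) ((tgeometry 4 (R.cubesPerDir (k + 1))).cubes X₀) -
        locE (tgeometry 4 (R.cubesPerDir (k + 1))).ι (tgeometry 4 (R.cubesPerDir (k + 1))).cubes
          (fun Z => ∑ ℓ' ∈ innerLabels (b13InnerData R) (k + 1) (domEmb R (k + 1) Z),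
            actOfLetters P Op 𝒴 dom Jc V ℓA (domEmb R (k + 1) Z) ℓ' o h₀) ((tgeometry 4 (R.cubesPerDir (k + 1))).cubes X₀)‖ ≤
      4 * (Real.exp 1 * 9 * 64 * K₀ 64 8 ^ 2) * A₁ * Real.exp (-(r₁ * (tsys 4 (R.cubesPerDir (k + 1))).dj X₀)) :=
  attachedPart_locE_le_of_actOfLetters_recordLabels_carriers R hk P Op 𝒴 dom Jc V ℓA hroom hm hN hq hg hO hH (bondsOfFineCubes hk)
    hkill X₀ hA₀ hA₁ hr₁ hrate hsmall hα₆ hκ h229 hs0 hs1 ht (fun W => card_bondsOfFineCubes_le_real hk W) hRR hAmp hϱ hϱA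

open Classical in
/-- **THE μ-PART (ROAD P1's SOURCE PENCIL) OF ROW NE5's CATALOGUE ACTIVITY AT THE CARRIERS OF RECORD WITH THE BONDS OF RECORD** — PART 2's
μ-END ONCE at `bondsOf := bondsOfFineCubes hk`, `hb₀ := card_bondsOfFineCubes_le_real hk` (`b₀ = 4·L^{4m′}`).  **(original docstring of
PART 2's μ-END follows)** (PART 2: §1's μ-END ONCE with the plug-ins of the attached carriers END above).  The source window `μ₁`∕`μ₀`∕`sμ` and
the direction `v` occur ONLY in `hH`, `hAmp` and the conclusion:
`‖E[Z ↦ Σ_{ℓ' ∈ innerLabels … (domEmb R (k+1) Z)} actOfLetters ℓA (domEmb R (k+1) Z) ℓ' o (h₀ + sμ•v)](X₀) − E[… o h₀](X₀)‖ ≤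
e·9·64·K₀(64,8)²·A·e^{−r₁·torusTreeLen X₀}·μ₀∕(μ₁ − μ₀)`. [folklore] -/
theorem muPart_locE_le_of_actOfLetters_recordLabels_carriersBonds {Win : Set (ℕ → ℝ)}
    {ctr : ℕ → (ℕ → ℝ) → R.carriers.BgB → Op × B13HistM P} {ROp RHist R' : ℕ → ℝ}
    (ℓA : ∀ X j, CoreLetters P Op 𝒴 dom Jc V X j)
    {mq bq N₀ : ℕ → R.carriers.Dom × InnerLabel R.carriers.Dom (Bnd R) → R.carriers.Dom → ℝ}
    (hroom : ∀ k, ROp k < R' k)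
    (hm : ∀ k, ∀ g ∈ Win, ∀ (U : R.carriers.BgB) (X : R.carriers.Dom), R.carriers.scale X = k → ∀ p, 0 < mq k p X)
    (hN : ∀ k, ∀ g ∈ Win, ∀ (U : R.carriers.BgB) (X : R.carriers.Dom), R.carriers.scale X = k →
      ∀ p : R.carriers.Dom × InnerLabel R.carriers.Dom (Bnd R),
      (∀ o ∈ ball (ctr k g U).1 (R' k),
        AEStronglyMeasurable ((ℓA p.1 p.2).N o) (coreOf P Op 𝒴 dom Jc V ℓA p.1 p.2).lam) ∧
      (∀ a, DifferentiableOn ℂ (fun o => (ℓA p.1 p.2).N o a) (ball (ctr k g U).1 (R' k))) ∧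
      (∀ o ∈ ball (ctr k g U).1 (R' k), ∀ a, ‖(ℓA p.1 p.2).N o a‖ ≤ N₀ k p X))
    (hq : ∀ k, ∀ g ∈ Win, ∀ (U : R.carriers.BgB) (X : R.carriers.Dom), R.carriers.scale X = k →
      ∀ p : R.carriers.Dom × InnerLabel R.carriers.Dom (Bnd R),
      (∀ o ∈ ball (ctr k g U).1 (R' k),
        AEStronglyMeasurable (Function.uncurry ((ℓA p.1 p.2).q o))
          ((coreOf P Op 𝒴 dom Jc V ℓA p.1 p.2).lam.prod volume)) ∧
      (∀ a v, DifferentiableOn ℂ (fun o => (ℓA p.1 p.2).q o a v) (ball (ctr k g U).1 (R' k))) ∧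
      (∀ o ∈ ball (ctr k g U).1 (R' k), ∀ a v, mq k p X * ‖v‖ ^ 2 - bq k p X ≤ ((ℓA p.1 p.2).q o a v).re))
    {g : ℕ → ℝ} (hg : g ∈ Win) {U : R.carriers.BgB} {o : Op} {h₀ v : B13HistM P} {μ₁ : ℝ}
    (hO : ‖o - (ctr (k + 1) g U).1‖ ≤ ROp (k + 1)) (hH : ‖h₀ - (ctr (k + 1) g U).2‖ + μ₁ * ‖v‖ ≤ RHist (k + 1))
    (hkill : ∀ Z : (tsys 4 (R.cubesPerDir (k + 1))).Dom, ∀ ℓ ∈ torusLabels hk Z,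
      ¬ (ℓ.Z₀ = trefineDom R.F.L (R.cubesPerDir (k + 1)) Z ∧
          ℓ.P ⊆ bondsOfFineCubes hk (ℓ.Z₀.1 \ ℓ.fam.biUnion fun Y : (tsys 4 (R.F.L * R.cubesPerDir (k + 1))).Dom => Y.1) ∧
          (ℓ.Z₀.1 \ ℓ.fam.biUnion fun Y : (tsys 4 (R.F.L * R.cubesPerDir (k + 1))).Dom => Y.1).card ≤ 2 * ℓ.P.card) →
      ∃ (b : V (domEmb R (k + 1) Z) (InnerLabel.ofTorus hk ℓ) →L[ℝ] ℝ) (thr : ℝ), thr ≤ 0 ∧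
        (b, thr, true) ∈ (ℓA (domEmb R (k + 1) Z) (InnerLabel.ofTorus hk ℓ)).cons)
    {A Rkp r₁ μ₀ : ℝ} (X₀ : (tsys 4 (R.cubesPerDir (k + 1))).Dom) {sμ : ℂ} (hA : 0 ≤ A) (hr₁ : 0 ≤ r₁)
    (hrate : r₁ + 2 * (64 * Real.log 162) + 2 ≤ Rkp)
    (hsmall : A * Real.exp (5 * r₁ + 1) * K₀ 64 8 * 9 * 64 ≤ 1)
    {δ κ α₆ Rc s t : ℝ} (hα₆ : 0 ≤ α₆)
    (hκ : 64 * Real.log 162 + 1 ≤ δ * κ) (h229 : Real.exp 1 * K₀ 64 8 * 64 * α₆ ≤ 1)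
    (hs0 : 0 ≤ s) (hs1 : s ≤ 1) (ht : 0 ≤ t)
    (hRR : Rkp ≤ Rc - 64 * (Real.exp (Rc * 5) * s * Real.exp ((4 * (R.F.L : ℝ) ^ (4 * R.m')) * t)))
    (hAmp : ∀ Z : (tsys 4 (R.cubesPerDir (k + 1))).Dom, Z.1 ⊆ X₀.1 → ∀ ℓ ∈ (torusLabels hk Z).filter fun ℓ =>
        ℓ.Z₀ = trefineDom R.F.L (R.cubesPerDir (k + 1)) Z ∧
          ℓ.P ⊆ bondsOfFineCubes hk (ℓ.Z₀.1 \ ℓ.fam.biUnion fun Y : (tsys 4 (R.F.L * R.cubesPerDir (k + 1))).Dom => Y.1) ∧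
          (ℓ.Z₀.1 \ ℓ.fam.biUnion fun Y : (tsys 4 (R.F.L * R.cubesPerDir (k + 1))).Dom => Y.1).card ≤ 2 * ℓ.P.card,
      (coreOf P Op 𝒴 dom Jc V ℓA (domEmb R (k + 1) Z) (InnerLabel.ofTorus hk ℓ)).lam.real univ *
          ((coreOf P Op 𝒴 dom Jc V ℓA (domEmb R (k + 1) Z) (InnerLabel.ofTorus hk ℓ)).wB *
              N₀ (k + 1) (domEmb R (k + 1) Z, InnerLabel.ofTorus hk ℓ) (domEmb R (k + 1) Z) *
            Real.exp (bq (k + 1) (domEmb R (k + 1) Z, InnerLabel.ofTorus hk ℓ) (domEmb R (k + 1) Z))) *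
          (Real.pi / (mq (k + 1) (domEmb R (k + 1) Z, InnerLabel.ofTorus hk ℓ) (domEmb R (k + 1) Z) / 2)) ^
            (Module.finrank ℝ (V (domEmb R (k + 1) Z) (InnerLabel.ofTorus hk ℓ)) / 2 : ℝ) *
        Real.exp ((coreOf P Op 𝒴 dom Jc V ℓA (domEmb R (k + 1) Z) (InnerLabel.ofTorus hk ℓ)).N₁ * (‖h₀‖ + μ₁ * ‖v‖)) ≤
      A * ((∏ Y ∈ ℓ.fam, (α₆ * Real.exp (-(δ * κ * torusTreeLen Y.1)) *
        Real.exp (-(Rc * (torusTreeLen Y.1 + 5))))) * (s ^ 2 * t) ^ ℓ.P.card))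
    (h0 : 0 < μ₀) (h01 : μ₀ < μ₁) (hμ : ‖sμ‖ ≤ μ₀) :
    ‖locE (tgeometry 4 (R.cubesPerDir (k + 1))).ι (tgeometry 4 (R.cubesPerDir (k + 1))).cubes
          (fun Z => ∑ ℓ' ∈ innerLabels (b13InnerData R) (k + 1) (domEmb R (k + 1) Z),
            actOfLetters P Op 𝒴 dom Jc V ℓA (domEmb R (k + 1) Z) ℓ' o (h₀ + sμ • v)) ((tgeometry 4 (R.cubesPerDir (k + 1))).cubes X₀) -
        locE (tgeometry 4 (R.cubesPerDir (k + 1))).ι (tgeometry 4 (R.cubesPerDir (k + 1))).cubes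
          (fun Z => ∑ ℓ' ∈ innerLabels (b13InnerData R) (k + 1) (domEmb R (k + 1) Z),
            actOfLetters P Op 𝒴 dom Jc V ℓA (domEmb R (k + 1) Z) ℓ' o h₀) ((tgeometry 4 (R.cubesPerDir (k + 1))).cubes X₀)‖ ≤
      Real.exp 1 * 9 * 64 * K₀ 64 8 ^ 2 * A * Real.exp (-(r₁ * (tsys 4 (R.cubesPerDir (k + 1))).dj X₀)) * (μ₀ / (μ₁ - μ₀)) :=
  muPart_locE_le_of_actOfLetters_recordLabels_carriers R hk P Op 𝒴 dom Jc V ℓA hroom hm hN hq hg hO hH (bondsOfFineCubes hk)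
    hkill X₀ hA hr₁ hrate hsmall hα₆ hκ h229 hs0 hs1 ht (fun W => card_bondsOfFineCubes_le_real hk W) hRR hAmp h0 h01 hμ

end Bonds

end Summit.QuantumFields.BalabanUV.T4Continuum.NE1p.DressedSmallFieldRecordLabelsCarriersBonds

end
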